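import Summits.AtomisticToContinuum.FouriersLaw.Theses.PhononMeanFreePath
import Summits.AtomisticToContinuum.FouriersLaw.Theorems.PhononMeanFreePathDefs
import Summits.AtomisticToContinuum.FouriersLaw.Theorems.CoherentDephasing.Negative.ScalingNormalForm

/-!
# Ray-monotonicity glue for crux `PhononMeanFreePath.CoherentDephasing` (stmt-AtomisticToContinuum-11810), line `Sketch`

The crux says: for the pinned anharmonic chain with both Langevin baths at temperature `T`, the
end-to-end pair correlation `r_N(t) = ⟨p₀, K_t p_N⟩ = pairCorr ω₂ lam β γ T N t` has `r_N²`
integrable on `(0,∞)` for every `N` and `N ∫₀^∞ r_N² → 0`. By the landed unit-temperature normal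
form (`Theorems/CoherentDephasing/Negative/ScalingNormalForm.lean`:
`coherentDephasing_iff_unit_temperature`) the crux is its `T = 1` slice over the whole coupling
quadrant `{lam, β > 0}`, and the weak-coupling support item `CoherentDephasingWeakCoupling`
(stmt-11813) is exactly its small-coupling CORNER `{0 < a, b ≤ ε₀(ω₂, γ)}`
(`coherentDephasingWeakCoupling_iff_corner`).

This file records the glue of the idea cards `heating-never-recoheres` /
`scaling-ward-monotone-transfer`: IF the corner holds AND the unit-temperature functional
`∫₀^∞ r_N²` is non-increasing (with transfer of integrability) up every coupling ray
`g ↦ (g a, g b)`, `g ≥ 1`, THEN the crux holds everywhere — every point `(A, B)` of the quadrant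
lies on a ray emanating from the corner (`g = max 1 (max (A/ε₀) (B/ε₀))`), and
`0 ≤ N ∫ r_N²(A, B) ≤ N ∫ r_N²(A/g, B/g) → 0` (`squeeze_zero`). Pure real analysis on top of the
two landed equivalences; `pairCorr` unfolds to the raw integrals of the route file by `rfl`.
-/

noncomputable section

open MeasureTheory Set Filter Topology

namespace Summit.AtomisticToContinuum.FouriersLaw.Theorems.CoherentDephasing.RayMonotone

open Literature.MathematicalPhysics.KineticTheory.HeatConduction (pinnedChain PhaseSpace)
open Summit.AtomisticToContinuum.FouriersLaw.Theses.PhononMeanFreePath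
open Summit.AtomisticToContinuum.FouriersLaw.Theorems.PhononMeanFreePath
open Summit.AtomisticToContinuum.FouriersLaw.Theorems.CoherentDephasing.Negative.ScalingNormalForm
  (coherentDephasing_iff_unit_temperature coherentDephasingWeakCoupling_iff_corner)

/-- **Ray-monotonicity glue.** If the weak-coupling corner `CoherentDephasingWeakCoupling` holds and,
at unit temperature, `∫₀^∞ r_N²` is non-increasing up every coupling ray `g ↦ (g a, g b)` (`g ≥ 1`,
including transfer of integrability of `r_N²` on `(0,∞)`), then `CoherentDephasing` holds at every
admissible parameter point: reduce to `T = 1` by `coherentDephasing_iff_unit_temperature`, put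
`g := max 1 (max (A/ε₀) (B/ε₀))`, `(a, b) := (A/g, B/g)` in the corner, and squeeze
`0 ≤ N ∫ r_N²(A, B) ≤ N ∫ r_N²(a, b) → 0`. [folklore] -/
theorem coherentDephasing_of_weakCoupling_of_rayMonotone :
    Summit.AtomisticToContinuum.FouriersLaw.Theses.PhononMeanFreePath.CoherentDephasingWeakCoupling →
    (∀ ω₂ a b γ : ℝ, 0 < ω₂ → 0 < a → 0 < b → 0 < γ → ∀ g : ℝ, 1 ≤ g → ∀ N : ℕ,
      IntegrableOn (fun t : ℝ => pairCorr ω₂ a b γ 1 N t ^ 2) (Set.Ioi 0) →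
      IntegrableOn (fun t : ℝ => pairCorr ω₂ (g * a) (g * b) γ 1 N t ^ 2) (Set.Ioi 0) ∧
        ∫ t in Set.Ioi (0 : ℝ), pairCorr ω₂ (g * a) (g * b) γ 1 N t ^ 2 ≤
          ∫ t in Set.Ioi (0 : ℝ), pairCorr ω₂ a b γ 1 N t ^ 2) →
    Summit.AtomisticToContinuum.FouriersLaw.Theses.PhononMeanFreePath.CoherentDephasing := by
  intro hW hR
  rw [coherentDephasing_iff_unit_temperature]
  intro ω₂ A B γ hω hA hB hγ
  obtain ⟨ε₀, hε, hc⟩ := (coherentDephasingWeakCoupling_iff_corner.1 hW) ω₂ γ hω hγ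
  -- the ray parameter `g ≥ 1` bringing `(A, B)` back into the corner
  set g : ℝ := max 1 (max (A / ε₀) (B / ε₀))
  have hg1 : 1 ≤ g := le_max_left _ _
  have hg0 : 0 < g := lt_of_lt_of_le one_pos hg1
  have hAg : A / ε₀ ≤ g := (le_max_left _ _).trans (le_max_right _ _)
  have hBg : B / ε₀ ≤ g := (le_max_right _ _).trans (le_max_right _ _)
  have ha : 0 < A / g := div_pos hA hg0
  have hb : 0 < B / g := div_pos hB hg0
  have hae : A / g ≤ ε₀ := by
    rw [div_le_iff₀ hg0]
    calc A = A / ε₀ * ε₀ := (div_mul_cancel₀ A hε.ne').symm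
      _ ≤ g * ε₀ := mul_le_mul_of_nonneg_right hAg hε.le
      _ = ε₀ * g := mul_comm _ _
  have hbe : B / g ≤ ε₀ := by
    rw [div_le_iff₀ hg0]
    calc B = B / ε₀ * ε₀ := (div_mul_cancel₀ B hε.ne').symm
      _ ≤ g * ε₀ := mul_le_mul_of_nonneg_right hBg hε.le
      _ = ε₀ * g := mul_comm _ _
  have hga : g * (A / g) = A := mul_div_cancel₀ A hg0.ne'
  have hgb : g * (B / g) = B := mul_div_cancel₀ B hg0.ne'
  -- the corner at `(A/g, B/g)`, read over `pairCorr` (definitional unfolding)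
  have hcorner : (∀ N : ℕ, IntegrableOn (fun t : ℝ => pairCorr ω₂ (A / g) (B / g) γ 1 N t ^ 2) (Ioi 0)) ∧
      Tendsto (fun N : ℕ => (N : ℝ) * ∫ t in Ioi (0 : ℝ), pairCorr ω₂ (A / g) (B / g) γ 1 N t ^ 2)
        atTop (𝓝 0) :=
    hc (A / g) (B / g) ha hb hae hbe
  -- monotone transfer up the ray to `(g · A/g, g · B/g) = (A, B)`
  have hray : ∀ N : ℕ, IntegrableOn (fun t : ℝ => pairCorr ω₂ A B γ 1 N t ^ 2) (Ioi 0) ∧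
      ∫ t in Ioi (0 : ℝ), pairCorr ω₂ A B γ 1 N t ^ 2 ≤
        ∫ t in Ioi (0 : ℝ), pairCorr ω₂ (A / g) (B / g) γ 1 N t ^ 2 := by
    intro N
    have h := hR ω₂ (A / g) (B / g) γ hω ha hb hγ g hg1 N (hcorner.1 N)
    rwa [hga, hgb] at h
  show (∀ N : ℕ, IntegrableOn (fun t : ℝ => pairCorr ω₂ A B γ 1 N t ^ 2) (Ioi 0)) ∧
      Tendsto (fun N : ℕ => (N : ℝ) * ∫ t in Ioi (0 : ℝ), pairCorr ω₂ A B γ 1 N t ^ 2) atTop (𝓝 0)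
  refine ⟨fun N => (hray N).1, ?_⟩
  exact squeeze_zero (fun N => mul_nonneg (Nat.cast_nonneg N)
      (setIntegral_nonneg measurableSet_Ioi fun t _ => sq_nonneg _))
    (fun N => mul_le_mul_of_nonneg_left (hray N).2 (Nat.cast_nonneg N)) hcorner.2

end Summit.AtomisticToContinuum.FouriersLaw.Theorems.CoherentDephasing.RayMonotone

end
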